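import Summits.ValiantsHypothesis.ValiantsHypothesis.Theorems.VPBoundarySquarePresentableSplit
import Literature.Computability.AlgebraicComplexity.GMQ16Lemma43Holds
import Literature.Computability.AlgebraicComplexity.GMQ16Prop35Holds
import Literature.Computability.AlgebraicComplexity.ValiantConjectureEquivProofs
import Literature.Computability.AlgebraicComplexity.PBoundedGrowth
import HarnessLib

/-!
# VPBoundarySquare — the POLYNOMIAL-ORDER case: the BC5 rung of `CollapseEmptiesBoundary`
and its S-case `ValiantAtPolyOrder` (decomp-valiant lens 3, gen 16)

Route of record `route-ValiantsHypothesis-VPBoundarySquare`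
(`closes (Q : EmptyBoundarySeparates) (P : CollapseEmptiesBoundary) : ValiantsHypothesis`).
This file is the kernel half of the route's tribunal T3 record (birth-certificate BC5, «witness of
weakness» for the attacked crux `P`): it fixes the REGIME of the proved rung, proves the rung in the
route's vocabulary, and certifies that `S` restricted to that regime is NOT a known theorem — it is
equivalent to `S` itself.

* The regime `IsPolyOrderVPLimit v f`: `f` is, level by level, a one-parameter degeneration OF
  POLYNOMIAL DEGREE `K(n) = poly(n)` (Grochow–Mulmuley–Qiao 2016, §3.3) of a `VP` family on
  p-bounded variable sets. It lies inside `closure(VP)` (`IsPolyOrderVPLimit.isVPBarFamily`, the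
  one-parameter-family argument of GMQ16 Prop. 3.5, tree `GMQ2016.approxComplexity_le_of_isLimit`),
  so it is a sub-regime of the domain of `P` and of the lever `U = ClosureDefinable`.
* THE RUNG: on the regime the boundary is empty UNCONDITIONALLY — `IsPolyOrderVPLimit.isVPFamily`
  (GMQ16 Lemma 4.3 = Bini / Bürgisser 2004 interpolation, tree `GMQ2016.lemma_4_3_holds`); hence
  `P` and `U` hold on the regime with no hypothesis at all (`collapseEmptiesBoundary_polyOrder`,
  `closureDefinable_polyOrder`), and `P` itself is EQUIVALENT to an order-reduction statement:
  `VP = VNP ⟹` every p-family in `closure(VP)` has polynomial approximation order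
  (`collapseEmptiesBoundary_iff_polyOrderReduction`).
* THE S-CASE: `ValiantAtPolyOrder` («some `VNP` p-family is not a polynomial-order degeneration of a
  `VP` family», the route's former aside #9, dropped at rev 6 for the item cap and restored here as a
  tree declaration) is EQUIVALENT to `S` (`valiantAtPolyOrder_iff_vh`): `S ⟹` it by the rung and
  Valiant's completeness of the permanent (tree `perNotPComputableComplex_iff_holds`); it `⟹ S`
  because every `VP` family is the degree-`0` degeneration of itself along the identity substitution
  (`GMQ2016.idSubst`; the identity lemmas of `GMQ16PDefinableDegenerations` are private and are
  re-derived here, `isDegenerationOfDegree_self`). So the rung's regime is one where `S` is not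
  known — the T3 reading «rung outside S's proved regime».

Honest framing: one unconditional lemma instance and implications between OPEN statements; nothing
here bears on `VP ≠ VNP`, on `closure(VP) ⊆ VNP`, or on `Q`.

References: Grochow–Mulmuley–Qiao 2016 (arXiv:1605.02815) §1.1, §3.3, Prop. 3.5, Lemma 4.3;
Bürgisser 2004 (the interpolation argument); Bürgisser 2000 Def. 2.4–2.5, Rem. 2.2; Valiant 1979;
BLMW 2011 §9.3 (Zariski `closure(VP)`).
-/

noncomputable section

set_option linter.dupNamespace false

open MvPolynomial
open scoped LaurentPolynomial
open Literature.Computability.AlgebraicComplexity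
open Literature.Computability.AlgebraicComplexity.GMQ2016
open Summit.ValiantsHypothesis.ValiantsHypothesis.Theses.VPBoundarySquare
open Summit.ValiantsHypothesis.ValiantsHypothesis.Theorems.VPBoundarySquarePresentableSplit

namespace Summit.ValiantsHypothesis.ValiantsHypothesis.Theorems.VPBoundarySquarePolyOrderCase

/-! ### The identity substitution: every polynomial is the degree-`0` degeneration of itself -/

section Identity

variable {F : Type*} [CommRing F]

/-- The identity substitution's forms are the variables (public re-derivation of the private lemma
of `GMQ16PDefinableDegenerations`). [cite: GrochowMulmuleyQiao2016, §1.1 (VP ⊆ VP*)] -/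
theorem substForm_idSubst (m : ℕ) (i : Fin m) :
    substForm (idSubst F m) i = (X i : MvPolynomial (Fin m) F[T;T⁻¹]) := by
  classical
  simp only [substForm, idSubst]
  rw [Finset.sum_eq_single i (fun j _ hj => by simp [hj]) (by simp)]
  simp

/-- Degenerating along the identity substitution is the coefficient embedding `F ⊆ F[t,t⁻¹]`.
[cite: GrochowMulmuleyQiao2016, §1.1 (VP ⊆ VP*)] -/
theorem degenerate_idSubst {m : ℕ} (g : MvPolynomial (Fin m) F) :
    degenerate g (idSubst F m) = map (algebraMap F F[T;T⁻¹]) g := by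
  unfold degenerate
  rw [show substForm (idSubst F m) = fun i => (X i : MvPolynomial (Fin m) F[T;T⁻¹]) from
    funext (substForm_idSubst m)]
  induction g using MvPolynomial.induction_on with
  | C a => simp
  | add p q hp hq => simp [hp, hq]
  | mul_X p i hp => simp [hp]

/-- Coefficients of a constant Laurent polynomial. [cite: GrochowMulmuleyQiao2016, §3.3] -/
theorem coeff_laurentC (c : F) (z : ℤ) :
    (LaurentPolynomial.C c).coeff z = if z = 0 then c else 0 := by
  rw [← LaurentPolynomial.single_eq_C, AddMonoidAlgebra.coeff_single, Finsupp.single_apply]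
  simp [eq_comm]

/-- `g = lim_{t→0} g` along the identity substitution. [cite: GrochowMulmuleyQiao2016, §1.1 (VP ⊆ VP*)] -/
theorem isLimit_idSubst {m : ℕ} (g : MvPolynomial (Fin m) F) :
    IsLimit g (degenerate g (idSubst F m)) := by
  intro μ
  rw [degenerate_idSubst, coeff_map]
  refine ⟨fun z hz => ?_, ?_⟩
  · rw [show (algebraMap F F[T;T⁻¹]) (coeff μ g) = LaurentPolynomial.C (coeff μ g) from rfl,
      coeff_laurentC, if_neg hz.ne]
  · rw [show (algebraMap F F[T;T⁻¹]) (coeff μ g) = LaurentPolynomial.C (coeff μ g) from rfl,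
      coeff_laurentC, if_pos rfl]

/-- The identity substitution has degree `0 ≤ K`. [cite: GrochowMulmuleyQiao2016, §1.1 (VP ⊆ VP*)] -/
theorem hasDegreeLE_idSubst (m K : ℕ) : HasDegreeLE K (idSubst F m) := by
  intro i j z hz
  unfold idSubst
  split_ifs
  · rw [show (1 : F[T;T⁻¹]) = LaurentPolynomial.C 1 from (map_one _).symm, coeff_laurentC,
      if_neg (by rintro rfl; simp at hz)]
  · simp

/-- Every polynomial is a one-parameter degeneration of degree `≤ K` of itself (any `K`; already
`K = 0`), along the identity substitution `y_i = x_i`. [cite: GrochowMulmuleyQiao2016, §1.1 (VP ⊆ VP*)] -/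
theorem isDegenerationOfDegree_self {m : ℕ} (K : ℕ) (g : MvPolynomial (Fin m) F) :
    IsDegenerationOfDegree K g g :=
  ⟨idSubst F m, hasDegreeLE_idSubst m K, isLimit_idSubst g⟩

end Identity

/-! ### The polynomial-order regime and the rung -/

/-- **The polynomial-order regime.** `f` (on the variables `Fin (v n)`) is, level by level, a
one-parameter degeneration OF POLYNOMIAL DEGREE `K(n) = poly(n)` (GMQ16 §3.3: affine forms with
Laurent-polynomial coefficients supported on `[-K(n), K(n)]`) of a `VP` family `g` on p-bounded
variable sets `Fin (l n)`. [cite: GrochowMulmuleyQiao2016, §3.3 and Lemma 4.3] -/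
def IsPolyOrderVPLimit (v : ℕ → ℕ) (f : ∀ n, MvPolynomial (Fin (v n)) ℂ) : Prop :=
  ∃ (l K : ℕ → ℕ) (g : ∀ n, MvPolynomial (Fin (l n)) ℂ),
    IsPBounded l ∧ IsPBounded K ∧ IsVPFamily g ∧ ∀ n, IsDegenerationOfDegree (K n) (g n) (f n)

namespace IsPolyOrderVPLimit

variable {v : ℕ → ℕ} {f : ∀ n, MvPolynomial (Fin (v n)) ℂ}

/-- The regime lies inside `closure(VP)`: `\underline{L}(f_n) ≤ L(g_n) + l(n)(2 v(n) + 1)` (the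
one-parameter-family argument of GMQ16 Prop. 3.5; the degree bound is not used). [cite: GrochowMulmuleyQiao2016, Prop. 3.5] -/
theorem isVPBarFamily (h : IsPolyOrderVPLimit v f) (hv : IsPBounded v) : IsVPBarFamily f := by
  obtain ⟨l, K, g, hl, -, hg, hdeg⟩ := h
  have hb : IsPBounded fun n => complexity (g n) + l n * (2 * v n + 1) :=
    IsPBounded.add_holds hg.2 (IsPBounded.mul_holds hl
      (IsPBounded.add_holds (IsPBounded.mul_holds (IsPBounded.const 2) hv) (IsPBounded.const 1)))
  refine IsPBounded.mono hb fun n => ?_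
  obtain ⟨a, -, hlim⟩ := hdeg n
  exact approxComplexity_le_of_isLimit (g n) (f n) a hlim

/-- **THE RUNG** (BC5 witness for `CollapseEmptiesBoundary`): on the polynomial-order regime the
boundary of `VP` is empty unconditionally — `f ∈ VP` (GMQ16 Lemma 4.3, Bini / Bürgisser 2004
interpolation; tree `GMQ2016.lemma_4_3_holds`). [cite: GrochowMulmuleyQiao2016, Lemma 4.3] -/
theorem isVPFamily (h : IsPolyOrderVPLimit v f) (hv : IsPBounded v) : IsVPFamily f := by
  obtain ⟨l, K, g, hl, hK, hg, hdeg⟩ := h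
  exact lemma_4_3_holds l v g f K hl hv hK hg hdeg

/-- The rung, `P`-shaped conclusion: `f` is p-computable. [cite: GrochowMulmuleyQiao2016, Lemma 4.3] -/
theorem isPComputable (h : IsPolyOrderVPLimit v f) (hv : IsPBounded v) : IsPComputable f :=
  (h.isVPFamily hv).2

/-- The rung, `U`-shaped conclusion: `f ∈ VNP` (`VP ⊆ VNP`). [cite: GrochowMulmuleyQiao2016, Lemma 4.3] [cite: Burgisser2000, §2.1] -/
theorem isVNPFamily (h : IsPolyOrderVPLimit v f) (hv : IsPBounded v) : IsVNPFamily f :=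
  IsVPFamily.isVNPFamily_holds' (h.isVPFamily hv)

/-- A `VP` family on p-bounded variable sets is in the regime (degree `0`, the family itself).
[cite: GrochowMulmuleyQiao2016, §1.1 (VP ⊆ VP*)] -/
theorem of_isVPFamily (hf : IsVPFamily f) (hv : IsPBounded v) : IsPolyOrderVPLimit v f :=
  ⟨v, fun _ => 0, f, hv, IsPBounded.const 0, hf, fun n => isDegenerationOfDegree_self 0 (f n)⟩

end IsPolyOrderVPLimit

/-- Variable count of a p-family on `Fin (v n)` is p-bounded. [cite: Burgisser2000, Def. 2.3] -/
theorem isPBounded_of_isPFamily {v : ℕ → ℕ} {f : ∀ n, MvPolynomial (Fin (v n)) ℂ}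
    (hpf : IsPFamily f) : IsPBounded v := by
  simpa using hpf.1

/-! ### The rung in the route's vocabulary -/

/-- `P = CollapseEmptiesBoundary` ON THE REGIME, unconditionally — the shape of `P` with
`IsVPBarFamily f` strengthened to `IsPolyOrderVPLimit v f`; the collapse hypothesis is not even used.
[cite: GrochowMulmuleyQiao2016, Lemma 4.3] -/
theorem collapseEmptiesBoundary_polyOrder (v : ℕ → ℕ) (f : ∀ n, MvPolynomial (Fin (v n)) ℂ)
    (hpf : IsPFamily f) (h : IsPolyOrderVPLimit v f) : IsPComputable f :=
  h.isPComputable (isPBounded_of_isPFamily hpf)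

/-- `U = ClosureDefinable` ON THE REGIME, unconditionally. [cite: GrochowMulmuleyQiao2016, Lemma 4.3] [cite: Burgisser2000, §2.1] -/
theorem closureDefinable_polyOrder (v : ℕ → ℕ) (f : ∀ n, MvPolynomial (Fin (v n)) ℂ)
    (hpf : IsPFamily f) (h : IsPolyOrderVPLimit v f) : IsVNPFamily f :=
  h.isVNPFamily (isPBounded_of_isPFamily hpf)

/-- **`P` as ORDER REDUCTION**: `CollapseEmptiesBoundary` is equivalent to «`VP = VNP ⟹` every
p-family in `closure(VP)` has POLYNOMIAL approximation order» (a p-computable family is the order-`0`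
degeneration of itself; conversely polynomial order de-borders by the rung). [cite: GrochowMulmuleyQiao2016, Lemma 4.3 and §1.1] -/
theorem collapseEmptiesBoundary_iff_polyOrderReduction :
    CollapseEmptiesBoundary ↔
      (VP ℂ = VNP ℂ → ∀ (v : ℕ → ℕ) (f : ∀ n, MvPolynomial (Fin (v n)) ℂ),
        IsPFamily f → IsVPBarFamily f → IsPolyOrderVPLimit v f) := by
  refine ⟨fun hP hEq v f hpf hbar => ?_, fun h hEq v f hpf hbar => ?_⟩
  · exact IsPolyOrderVPLimit.of_isVPFamily ⟨hpf, hP hEq v f hpf hbar⟩ (isPBounded_of_isPFamily hpf)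
  · exact (h hEq v f hpf hbar).isPComputable (isPBounded_of_isPFamily hpf)

/-! ### The S-case of the regime: `ValiantAtPolyOrder ⟺ S` -/

/-- **S-CASE of the BC5 rung's regime** (the route's former aside #9 `ValiantAtPolyOrder`, text
verbatim): Valiant's hypothesis restricted to polynomial approximation ORDER — NOT every `VNP` family
(variables `Fin (v n)`) is a polynomial-order one-parameter degeneration (GMQ16 §3.3) of a `VP`
family on p-bounded variable sets. Equivalent to `S` (`valiantAtPolyOrder_iff_vh`), hence OPEN; it
is recorded as a conjecture, never asserted. [cite: GrochowMulmuleyQiao2016, §3.3, Lemma 4.3] [cite: Valiant1979] -/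
@[conjecture]
def ValiantAtPolyOrder : Prop :=
  ¬ ∀ (v : ℕ → ℕ) (f : ∀ n, MvPolynomial (Fin (v n)) ℂ),
      Literature.Computability.AlgebraicComplexity.IsVNPFamily f →
        ∃ (l K : ℕ → ℕ) (g : ∀ n, MvPolynomial (Fin (l n)) ℂ),
          Literature.Computability.AlgebraicComplexity.IsPBounded l ∧
            Literature.Computability.AlgebraicComplexity.IsPBounded K ∧
              Literature.Computability.AlgebraicComplexity.IsVPFamily g ∧
                ∀ n, Literature.Computability.AlgebraicComplexity.GMQ2016.IsDegenerationOfDegree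
                  (K n) (g n) (f n)

/-- Unfolding: `ValiantAtPolyOrder` says some `VNP` family is outside the polynomial-order regime.
[cite: GrochowMulmuleyQiao2016, §3.3] -/
theorem valiantAtPolyOrder_iff :
    ValiantAtPolyOrder ↔
      ¬ ∀ (v : ℕ → ℕ) (f : ∀ n, MvPolynomial (Fin (v n)) ℂ), IsVNPFamily f → IsPolyOrderVPLimit v f :=
  Iff.rfl

/-- The permanent family on the variables `Fin (n·n)`. [cite: Burgisser2000, (2.1)] -/
def perSq (n : ℕ) : MvPolynomial (Fin (n * n)) ℂ :=
  MvPolynomial.rename (finProdFinEquiv (m := n) (n := n)) (perPoly (Fin n) ℂ)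

/-- `(perSq_n) ∈ VNP`. [cite: Valiant1979] [cite: Burgisser2000, Rem. 2.2] -/
theorem isVNPFamily_perSq : IsVNPFamily perSq := by
  have h := (isVNPFamily_renameEquiv_iff (σ := fun n => Fin n × Fin n)
    (fun n => finProdFinEquiv (m := n) (n := n)) (fun n => perPoly (Fin n) ℂ)).2
    (isVNPFamily_perPoly_holds ℂ)
  show IsVNPFamily (fun n => MvPolynomial.rename (finProdFinEquiv (m := n) (n := n)) (perPoly (Fin n) ℂ))
  simpa only [MvPolynomial.renameEquiv_apply] using h

/-- `L(per_n) ≤ L(perSq_n)` (rename back along the inverse equivalence). [cite: Burgisser2000, Rem. 2.2] -/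
theorem complexity_perPoly_le_perSq (n : ℕ) :
    complexity (perPoly (Fin n) ℂ) ≤ complexity (perSq n) := by
  have h := complexity_rename_le_holds' (finProdFinEquiv (m := n) (n := n)).symm (perSq n)
  simp only [perSq, MvPolynomial.rename_rename, Equiv.symm_comp_self,
    MvPolynomial.rename_id_apply] at h
  exact h

/-- `S ⟹` not every `VNP` family (variables `Fin (v n)`) is p-computable (Valiant's completeness of
the permanent, tree `perNotPComputableComplex_iff_holds`). [cite: Valiant1979] [cite: Burgisser2000, Ch. 2] -/
theorem not_vnp_subset_pComputable_of_vh (hS : _root_.ValiantsHypothesis) :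
    ¬ ∀ (v : ℕ → ℕ) (f : ∀ n, MvPolynomial (Fin (v n)) ℂ), IsVNPFamily f → IsPComputable f := by
  intro H
  have hcomp : IsPComputable perSq := H (fun n => n * n) perSq isVNPFamily_perSq
  exact perNotPComputableComplex_iff_holds.mpr hS
    (IsPBounded.mono hcomp fun n => complexity_perPoly_le_perSq n)

/-- **`S ⟹ ValiantAtPolyOrder`**: if every `VNP` family were a polynomial-order degeneration of a
`VP` family, every `VNP` family would be p-computable by the rung (GMQ16 Lemma 4.3), contradicting
`S`. [cite: GrochowMulmuleyQiao2016, Lemma 4.3] [cite: Valiant1979] -/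
theorem valiantAtPolyOrder_of_vh (hS : _root_.ValiantsHypothesis) : ValiantAtPolyOrder := by
  rw [valiantAtPolyOrder_iff]
  intro H
  exact not_vnp_subset_pComputable_of_vh hS fun v f hf =>
    (H v f hf).isPComputable (isPBounded_of_isPFamily hf.1)

/-- **`ValiantAtPolyOrder ⟹ S`**: under `VP = VNP` every `VNP` family is a `VP` family, hence the
degree-`0` degeneration of itself — inside the regime. [cite: GrochowMulmuleyQiao2016, §1.1 (VP ⊆ VP*)] [cite: Burgisser2000, Def. 2.4–2.5] -/
theorem vh_of_valiantAtPolyOrder (h : ValiantAtPolyOrder) : _root_.ValiantsHypothesis := by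
  rw [valiantAtPolyOrder_iff] at h
  change VP ℂ ≠ VNP ℂ
  intro hEq
  exact h fun v f hf =>
    IsPolyOrderVPLimit.of_isVPFamily ⟨hf.1, isPComputable_of_isVNPFamily_of_vp_eq_vnp hEq hf⟩
      (isPBounded_of_isPFamily hf.1)

/-- **`ValiantAtPolyOrder ⟺ S`**: the S-case of the rung's regime is exactly as hard as the summit,
in particular NOT a theorem in scope — the rung (`IsPolyOrderVPLimit.isVPFamily`) lies outside `S`'s
proved regime. [cite: GrochowMulmuleyQiao2016, §1.1, Lemma 4.3] [cite: Valiant1979] -/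
theorem valiantAtPolyOrder_iff_vh : ValiantAtPolyOrder ↔ _root_.ValiantsHypothesis :=
  ⟨vh_of_valiantAtPolyOrder, valiantAtPolyOrder_of_vh⟩

/-- The S-case in the route's coordinates: `ValiantAtPolyOrder ⟸ Q ∧ P` (through `closes`).
[cite: GrochowMulmuleyQiao2016, Lemma 4.3] -/
theorem valiantAtPolyOrder_of_closes (hQ : EmptyBoundarySeparates) (hP : CollapseEmptiesBoundary) :
    ValiantAtPolyOrder :=
  valiantAtPolyOrder_of_vh (closes hQ hP)

end Summit.ValiantsHypothesis.ValiantsHypothesis.Theorems.VPBoundarySquarePolyOrderCase
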